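import Mathlib

/-!
# Tier4/Line1/RightInvariantOfFundamentalDomain — the GENERIC half of (I1-d) of LINE L1 (unimodularity)

Blind re-derivation cell `pub-hodge-repro`, Tier 4 (README §9–§10), seat t4-L1-p5 (prover, LINE L1, gen 0).
Mathlib only.  (I1-d) `haar_rightInvariant` of `Skeleton.lean` v0.8 (12c8528bc811170c…, L544) asks that every Haar
measure on `U(W)(𝔸_k)` be right invariant.  The planner's proof sketch — «a fundamental domain `D` of the discrete
subgroup `G(k)` and its right translate `D g` are both fundamental domains for the same left action, so
`μ(D g) = μ(D)` with `0 < μ(D) < ∞`, and the modular function is `1`» — is carried out here ONCE, for any Haar measure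
`μ` on a σ-compact locally compact group `G` and any countable subgroup `Γ` with a relatively compact fundamental
domain: the right translate `map (· * g) μ` is again a Haar measure, so by Mathlib's uniqueness
(`measure_isMulInvariant_eq_smul_of_isCompact_closure`, extended to all Borel sets by σ-compactness) it is
`c • μ` with `c = haarScalarFactor (map (· * g) μ) μ`; evaluating on the fundamental domain `D` and on its translate
`D g⁻¹ = (· * g)⁻¹' D` (a fundamental domain for the same action, `IsFundamentalDomain.preimage_of_equiv`) gives
`c · μ(D) = μ(D)`, and `0 < μ(D) < ∞` forces `c = 1`.

What remains of (I1-d) after this file: (I1-c) itself (the relatively compact fundamental domain) and the two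
topological facts `LocallyCompactSpace (GA W)`, `SigmaCompactSpace (GA W)` — both true (`𝔸_k` is locally compact and
σ-compact, `U(W)(𝔸_k)` is closed in `GL₄(𝔸_k)`) but NOT derivable from Mathlib rev 81a5d257c8e4, which has no
compactness of the local integers `𝓞_v` and no local compactness of the finite adele ring (repair census).

Nothing here says anything about the status of the Hodge conjecture for CM abelian varieties, which is NOT proved
(HC_CM is NOT proved by anyone in this repository).
-/

set_option autoImplicit false

noncomputable section

namespace Summit.Ventures.HodgeRepro.Tier4.Line1

open MeasureTheory Topology Set
open scoped ENNReal NNReal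

section RightInvariant

variable {G : Type*} [Group G] [TopologicalSpace G] [IsTopologicalGroup G] [LocallyCompactSpace G]
  [SigmaCompactSpace G] [MeasurableSpace G] [BorelSpace G]

/-- On a σ-compact locally compact group, two left-invariant measures finite on compacts are proportional on every
set (Mathlib's uniqueness on relatively compact sets, extended by the compact exhaustion). -/
theorem eq_haarScalarFactor_smul_of_sigmaCompact (μ' μ : Measure G) [μ.IsHaarMeasure]
    [IsFiniteMeasureOnCompacts μ'] [μ'.IsMulLeftInvariant] :
    μ' = Measure.haarScalarFactor μ' μ • μ := by
  ext s _
  set c := Measure.haarScalarFactor μ' μ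
  have key : ∀ t : Set G, IsCompact (closure t) → μ' t = (c : ℝ≥0∞) * μ t := fun t ht =>
    Measure.measure_isMulInvariant_eq_smul_of_isCompact_closure μ' μ ht
  have hmono : Monotone fun n => s ∩ compactCovering G n := fun m n hmn =>
    Set.inter_subset_inter_right _ (compactCovering_subset G hmn)
  have hs' : s = ⋃ n, s ∩ compactCovering G n := by
    rw [← Set.inter_iUnion, iUnion_compactCovering, Set.inter_univ]
  have hcpt : ∀ n, IsCompact (closure (s ∩ compactCovering G n)) := fun n =>
    (isCompact_compactCovering G n).closure_of_subset Set.inter_subset_right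
  calc μ' s = μ' (⋃ n, s ∩ compactCovering G n) := by rw [← hs']
    _ = ⨆ n, μ' (s ∩ compactCovering G n) := hmono.measure_iUnion
    _ = ⨆ n, (c : ℝ≥0∞) * μ (s ∩ compactCovering G n) := by
        simp only [key _ (hcpt _)]
    _ = (c : ℝ≥0∞) * ⨆ n, μ (s ∩ compactCovering G n) := (ENNReal.mul_iSup _ _).symm
    _ = (c : ℝ≥0∞) * μ (⋃ n, s ∩ compactCovering G n) := by rw [hmono.measure_iUnion]
    _ = (c : ℝ≥0∞) * μ s := by rw [← hs']
    _ = (c • μ) s := (Measure.coe_nnreal_smul_apply c μ s).symm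

/-- The right translate of a Haar measure on a σ-compact locally compact group is a multiple of it. -/
theorem map_mul_right_eq_haarScalarFactor_smul (μ : Measure G) [μ.IsHaarMeasure] (g : G) :
    Measure.map (· * g) μ = Measure.haarScalarFactor (Measure.map (· * g) μ) μ • μ :=
  eq_haarScalarFactor_smul_of_sigmaCompact _ μ

/-- **The generic half of (I1-d).**  A Haar measure `μ` on a σ-compact locally compact group `G` admitting a
relatively compact fundamental domain `D` for a countable subgroup `Γ` is right invariant (`G` is unimodular): the
modular factor `c` of `g` satisfies `c · μ(D) = μ(D g⁻¹) = μ(D)` with `0 < μ(D) < ∞`. -/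
theorem isMulRightInvariant_of_isFundamentalDomain (μ : Measure G) [μ.IsHaarMeasure]
    (Γ : Subgroup G) [Countable Γ] {D : Set G} (hD : IsFundamentalDomain Γ D μ)
    (hDc : IsCompact (closure D)) : μ.IsMulRightInvariant := by
  refine ⟨fun g => ?_⟩
  set c := Measure.haarScalarFactor (Measure.map (· * g) μ) μ with hc
  have hmap : Measure.map (· * g) μ = c • μ := map_mul_right_eq_haarScalarFactor_smul μ g
  -- `(· * g) ⁻¹' D = D g⁻¹` is a fundamental domain for the same left action
  have hac : c • μ ≪ μ := (Measure.AbsolutelyContinuous.refl μ).smul_left c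
  have hqmp : Measure.QuasiMeasurePreserving (· * g) μ μ := by
    refine ⟨measurable_mul_const g, ?_⟩
    rw [hmap]
    exact hac
  have hD' : IsFundamentalDomain Γ ((· * g) ⁻¹' D) μ :=
    hD.preimage_of_equiv hqmp (e := id) Function.bijective_id (fun γ x => by
      show (γ • x) * g = γ • (x * g)
      simp only [Subgroup.smul_def, smul_eq_mul, mul_assoc])
  -- the measure of `D` is positive and finite
  have hμne : μ ≠ 0 := NeZero.ne μ
  have hD0 : μ D ≠ 0 := hD.measure_ne_zero hμne
  have hDtop : μ D ≠ ∞ :=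
    ne_top_of_le_ne_top hDc.measure_lt_top.ne (measure_mono subset_closure)
  -- the translate has the same measure, and also `c` times it
  have h1 : μ ((· * g) ⁻¹' D) = μ D := hD'.measure_eq hD
  have h2 : Measure.map (· * g) μ D = μ ((· * g) ⁻¹' D) := by
    have := (MeasurableEquiv.mulRight g).map_apply (μ := μ) D
    simpa [MeasurableEquiv.coe_mulRight] using this
  have h3 : (c : ℝ≥0∞) * μ D = μ D := by
    rw [← Measure.coe_nnreal_smul_apply, ← hmap, h2, h1]
  have hc1 : (c : ℝ≥0∞) = 1 := by
    have : (c : ℝ≥0∞) * μ D = 1 * μ D := by rw [h3, one_mul]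
    exact (ENNReal.mul_left_inj hD0 hDtop).1 this
  have hc1' : c = 1 := by exact_mod_cast hc1
  rw [hmap, hc1', one_smul]

end RightInvariant

end Summit.Ventures.HodgeRepro.Tier4.Line1

end
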